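import Summits.AtomisticToContinuum.Crystallization.Theorems.OverbindingBudgetEnergySquareExtinction

/-!
# OverbindingBudget · decomp-a2c lens-4 g34 — part XXII-I: the tube leaves 7c″/7c‴ re-pointed to the PINNED boxes (critic row 502 (B), repair R-a)

Helper file under `--supports stmt-AtomisticToContinuum-31280` (RDEF = `Theses.OverbindingBudget.RobustDefectLimitWindows`); closes nothing.

D-0172 «the leaf is what the cone consumes».  In the cone of record the annulus exclusion 7c″ `RegistryPinningW Λ₁ ρ₀ ρ₁` and the convex tube data 7c‴
`TubeConvexRef Λ₁ ρ₀` are INSTANTIATED only inside `basalReferenceCP_of_pinning` / `basalGapRigidityP_of_uniqRef`, i.e. at the reference `w′` that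
`BasalReferenceCP Λ₁ ρ s₁ s₂ t₁ t₂` produces UNDER the pinning hypothesis `Pinned s₁ s₂ a b ∨ PinnedSq t₁ t₂ a b` (answer to row 502 (B): YES — 7c‴ is
applied only to references over cells already pinned in the boxes; the reference is the registry profile within `r″ = 3/500` of `reg a b n c σ u v` with
`c` EXACTLY balanced, `IsBalanced a b n c`, i.e. the census's TRACKED equilibrium `(u⋆(a,b), h₀(a,b))`; the cone literal bounding its deviation from the
configuration is R3geo's `τ₀ = 3/20` + `BalancedLocus`'s `τ = 1/40` ≤ `r′ = 7/40`, then `ρ₁ = r′ + r″ ≤ 3/16`, and 7c″ shrinks the tube to `ρ₀ = 1/40`).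
As TYPED, however, both leaves quantify over every admissible cell.  This file types their P-twins with the box predicate ADDED to the binders —
* 7c″P `RegistryPinningP Λ₁ ρ₀ ρ₁ s₁ s₂ t₁ t₂`, 7c‴P `TubeConvexRefP Λ₁ ρ s₁ s₂ t₁ t₂` (and `TubeUniquenessRefP`), each WEAKER than its W twin
  (forgetful seams `registryPinningP_of_W`, `tubeConvexRefP_of_ref`) —
re-proves the two consuming seams with the hypothesis threaded (`basalReferenceCP_of_pinningP`, `basalGapRigidityP_of_uniqRefP`,
`tubeUniquenessRefP_of_tubeConvexRefP` via lens-3's pointwise `incr_eq_of_tubeConvex`), and re-derives the cones: the general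
`rdef_of_grossU_shape_gluing_pinningU_convexRefP_registry` and, at the numbers of record, XXX `rdef_thirtieth_of_recordK_boxed_ref (s₁ s₂ h₀ κ′)`
(energy-fed, square branch extinct: with the empty square box the box predicate IS `Pinned s₁ s₂ a b`, so TAG 182's object is literally the T-box
family) and XXX-S `rdef_thirtieth_of_recordK_boxedS_ref (s₁ s₂ t₁ t₂ h₀ h₁ κ′)` (square box symbolic).  lens-3 may later re-home the P-twins next to
`TubeConvexRef`; the statements here are the binder lists VERBATIM + one hypothesis, so a re-homing is a one-line `Iff.rfl` seam.
-/

noncomputable section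

namespace Summit.AtomisticToContinuum.Crystallization.Theorems.OverbindingBudgetEnergyTubeBox

open Metric
open scoped RealInnerProductSpace
open Literature.MathematicalPhysics.StatisticalMechanics (lennardJones groundStateEnergy)
open Summit.AtomisticToContinuum.Crystallization.Theses.OverbindingBudget (RobustDefectLimitWindows)
open Summit.AtomisticToContinuum.Crystallization.Theses.PricedLinkCensus (ChargedEnergyGap)
open Summit.AtomisticToContinuum.Crystallization.Theorems.ChargedEnergyGapNegative (eStar)
open Summit.AtomisticToContinuum.Crystallization.Theorems.OverbindingBudgetGradedBareness (CleanlessExcessT)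
open Summit.AtomisticToContinuum.Crystallization.Theorems.OverbindingBudgetCoherentCut (CoherentResidual)
open Summit.AtomisticToContinuum.Crystallization.Theorems.OverbindingBudgetUniformCutStatements (GrossCleanBallsU)
open Summit.AtomisticToContinuum.Crystallization.Theorems.OverbindingBudgetElasticSplitScale (CompressedVirialLaw)
open Summit.AtomisticToContinuum.Crystallization.Theorems.OverbindingBudgetElasticSplitShear (StressFree)
open Summit.AtomisticToContinuum.Crystallization.Theorems.ChartedPlanarOrderChunkFloor (E3)
open Summit.AtomisticToContinuum.Crystallization.Theorems.ChartedPlanarOrderRigidityDoor (IsNash)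
open Summit.AtomisticToContinuum.Crystallization.Theorems.ChartedPlanarOrderDensityDichotomy (μS IsSep)
open Summit.AtomisticToContinuum.Crystallization.Theorems.ChartedPlanarOrderDoorLayered (Layered)
open Summit.AtomisticToContinuum.Crystallization.Theorems.ChartedPlanarOrderProfileSlavingLJ (IsStacked gapStress incr tube translation_iff_incr_eq)
open Summit.AtomisticToContinuum.Crystallization.Theorems.ChartedPlanarOrderTubeConvex (TubeConvexData TubeConvexRef incr_eq_of_tubeConvex)
open Summit.AtomisticToContinuum.Crystallization.Theorems.OverbindingBudgetPeriodicCleanOrStrained (UniformlyClean)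
open Summit.AtomisticToContinuum.Crystallization.Theorems.OverbindingBudgetScaleWidening (IsCleanW DoorPeriodicW)
open Summit.AtomisticToContinuum.Crystallization.Theorems.OverbindingBudgetTwoShellShape (TwoShellShape BarlowGluingW)
open Summit.AtomisticToContinuum.Crystallization.Theorems.OverbindingBudgetStackedRigidityW (StackedReductionW GapStressVanishesW
  uniformlyClean_translate layered_add_const)
open Summit.AtomisticToContinuum.Crystallization.Theorems.OverbindingBudgetStackedRigidityRef (RegistryPinningW isSep_of_uniformlyClean incr_mem_tube_symm)
open Summit.AtomisticToContinuum.Crystallization.Theorems.OverbindingBudgetStackedRigidityUniq (TubeUniquenessRef)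
open Summit.AtomisticToContinuum.Crystallization.Theorems.OverbindingBudgetRegistryCut (IsUnitNormal Pinned RegistryLocalisationW RegistryResidual
  RegistryTube RegistryMetric RegistryZeroExists zeroExists_of_residual_tube)
open Summit.AtomisticToContinuum.Crystallization.Theorems.OverbindingBudgetRegistrySquare (PinnedSq)
open Summit.AtomisticToContinuum.Crystallization.Theorems.OverbindingBudgetRegistryDichotomy (RegistryGeometryW BalancedLocus SqRegistryLocalisationW
  SqRegistryGeometryW SqBalancedHeight SqRegistryMetric registryLocalisationW_of_geometry_locus sqRegistryLocalisationW_of_geometry_height)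
open Summit.AtomisticToContinuum.Crystallization.Theorems.OverbindingBudgetRegistryDichotomyCW (RegistryMetricCW SqRegistryMetricCW)
open Summit.AtomisticToContinuum.Crystallization.Theorems.OverbindingBudgetEnergyPinning (StackedCellPinningU BasalGapRigidityP BasalReferenceCP
  basalReferenceCP_of_registry rdef_of_grossU_shape_gluing_stackedP)
open Summit.AtomisticToContinuum.Crystallization.Theorems.OverbindingBudgetEnergyStraightening (StraightenedFloor StraightCellEnergyT StraightCellEnergyS)
open Summit.AtomisticToContinuum.Crystallization.Theorems.OverbindingBudgetEnergyStraighteningHeights (stackedCellPinningU_of_straight_band)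
open Summit.AtomisticToContinuum.Crystallization.Theorems.OverbindingBudgetEnergySquareExtinction (SquareCellsExtinct stackedCellPinningU_of_sqExtinct
  sqRegistryGeometryW_empty sqBalancedHeight_empty sqRegistryMetricCW_empty)

/-! ## §1 The P-twins of 7c″ and 7c‴ (box predicate added to the binders) -/

/-- **7c″P · `RegistryPinningP Λ₁ ρ₀ ρ₁ s₁ s₂ t₁ t₂`** — annulus exclusion `RegistryPinningW Λ₁ ρ₀ ρ₁` over a PINNED cell only (binders verbatim +
`Pinned s₁ s₂ a b ∨ PinnedSq t₁ t₂ a b`).  WEAKER than 7c″.  Why it might fail: as 7c″, on the box sub-family only. [CERT·S on the box family] [piece] -/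
def RegistryPinningP (Λ₁ ρ₀ ρ₁ s₁ s₂ t₁ t₂ : ℝ) : Prop :=
  ∀ δ : ℝ, 0 < δ → ∀ (a b : E3) (w : ℤ → E3), IsStacked a b w → LinearIndependent ℝ ![a, b] →
    ‖a‖ ≤ Λ₁ → ‖b‖ ≤ Λ₁ → IsSep δ (Layered a b w) → IsCleanW (μS (Layered a b w)) → IsNash (μS (Layered a b w)) →
    StressFree (Layered a b w) → (∀ m : ℤ, gapStress a b m (incr w) = 0) → (Pinned s₁ s₂ a b ∨ PinnedSq t₁ t₂ a b) →
    ∀ w' : ℤ → E3, IsStacked a b w' → (∀ m : ℤ, gapStress a b m (incr w') = 0) → UniformlyClean (Layered a b w') →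
      (∀ m : ℤ, incr w' m ∈ tube w ρ₁ m) → ∀ m : ℤ, incr w' m ∈ tube w ρ₀ m

/-- **7c‴P · `TubeConvexRefP Λ₁ ρ s₁ s₂ t₁ t₂`** — lens-3's `TubeConvexRef Λ₁ ρ` over a PINNED cell only (binders verbatim + the box predicate): convex
tube data at radius `ρ` round every separated, two-shell-clean, uniformly clean, zero-gap-stress stacked REFERENCE over an in-box cell — the census's
TAG 182 object literally (with the empty square box: the T-box family, tracked equilibrium `(u⋆(a,b), h₀(a,b))`).  WEAKER than 7c‴.  Why it might fail:
HessCert margins under in-box distortion (`≤ 0.5 %`) — healthy at `b = 0.95/1.00` (C182). [CERT·M on the box family] [piece] -/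
def TubeConvexRefP (Λ₁ ρ s₁ s₂ t₁ t₂ : ℝ) : Prop :=
  ∀ δ : ℝ, 0 < δ → ∀ (a b : E3) (w' : ℤ → E3), IsStacked a b w' → LinearIndependent ℝ ![a, b] → ‖a‖ ≤ Λ₁ → ‖b‖ ≤ Λ₁ →
    IsSep δ (Layered a b w') → IsCleanW (μS (Layered a b w')) → (∀ m : ℤ, gapStress a b m (incr w') = 0) →
    UniformlyClean (Layered a b w') → (Pinned s₁ s₂ a b ∨ PinnedSq t₁ t₂ a b) → TubeConvexData a b w' ρ

/-- **7c♭P · `TubeUniquenessRefP Λ₁ ρ s₁ s₂ t₁ t₂`** — `TubeUniquenessRef Λ₁ ρ` over a pinned cell only. [interface] -/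
def TubeUniquenessRefP (Λ₁ ρ s₁ s₂ t₁ t₂ : ℝ) : Prop :=
  ∀ δ : ℝ, 0 < δ → ∀ (a b : E3) (w' : ℤ → E3), IsStacked a b w' → LinearIndependent ℝ ![a, b] → ‖a‖ ≤ Λ₁ → ‖b‖ ≤ Λ₁ →
    IsSep δ (Layered a b w') → IsCleanW (μS (Layered a b w')) → (∀ m : ℤ, gapStress a b m (incr w') = 0) →
    UniformlyClean (Layered a b w') → (Pinned s₁ s₂ a b ∨ PinnedSq t₁ t₂ a b) →
    ∀ w : ℤ → E3, IsStacked a b w → (∀ m : ℤ, incr w m ∈ tube w' ρ m) → (∀ m : ℤ, gapStress a b m (incr w) = 0) → incr w = incr w'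

/-! ## §2 Forgetful seams and the re-threaded consumers (PROVED) -/

/-- `RegistryPinningW → RegistryPinningP`. [this file] -/
theorem registryPinningP_of_W {Λ₁ ρ₀ ρ₁ s₁ s₂ t₁ t₂ : ℝ} (h : RegistryPinningW Λ₁ ρ₀ ρ₁) : RegistryPinningP Λ₁ ρ₀ ρ₁ s₁ s₂ t₁ t₂ :=
  fun δ hδ a b w hst hab ha hb hs hc hn hf hz _ => h δ hδ a b w hst hab ha hb hs hc hn hf hz

/-- `TubeConvexRef → TubeConvexRefP`. [this file] -/
theorem tubeConvexRefP_of_ref {Λ₁ ρ s₁ s₂ t₁ t₂ : ℝ} (h : TubeConvexRef Λ₁ ρ) : TubeConvexRefP Λ₁ ρ s₁ s₂ t₁ t₂ :=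
  fun δ hδ a b w' hst hab ha hb hs hc hz hUC _ => h δ hδ a b w' hst hab ha hb hs hc hz hUC

/-- `TubeUniquenessRef → TubeUniquenessRefP`. [this file] -/
theorem tubeUniquenessRefP_of_ref {Λ₁ ρ s₁ s₂ t₁ t₂ : ℝ} (h : TubeUniquenessRef Λ₁ ρ) : TubeUniquenessRefP Λ₁ ρ s₁ s₂ t₁ t₂ :=
  fun δ hδ a b w' hst hab ha hb hs hc hz hUC _ => h δ hδ a b w' hst hab ha hb hs hc hz hUC

/-- `TubeConvexRefP → TubeUniquenessRefP` (lens-3's pointwise `incr_eq_of_tubeConvex`). [this file] -/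
theorem tubeUniquenessRefP_of_tubeConvexRefP {Λ₁ ρ s₁ s₂ t₁ t₂ : ℝ} (hT : TubeConvexRefP Λ₁ ρ s₁ s₂ t₁ t₂) :
    TubeUniquenessRefP Λ₁ ρ s₁ s₂ t₁ t₂ := by
  intro δ hδ a b w' hst' hab ha hb hsep hcl hzero' hUC hp w _hst htube hzero
  exact (incr_eq_of_tubeConvex (hT δ hδ a b w' hst' hab ha hb hsep hcl hzero' hUC hp) htube (fun m => by rw [hzero m, hzero' m])).symm

/-- **Seam, PROVED.** Annulus exclusion over a pinned cell: `BasalReferenceCP Λ₁ ρ₁ … → RegistryPinningP Λ₁ ρ₀ ρ₁ … → BasalReferenceCP Λ₁ ρ₀ …`. [this file] -/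
theorem basalReferenceCP_of_pinningP {Λ₁ ρ₀ ρ₁ s₁ s₂ t₁ t₂ : ℝ} (hR : BasalReferenceCP Λ₁ ρ₁ s₁ s₂ t₁ t₂)
    (hP : RegistryPinningP Λ₁ ρ₀ ρ₁ s₁ s₂ t₁ t₂) : BasalReferenceCP Λ₁ ρ₀ s₁ s₂ t₁ t₂ := by
  intro δ hδ a b w hst hab ha hb hs hc hn hf hz hp
  obtain ⟨w', hst', htube, hz', hUC, hcl'⟩ := hR δ hδ a b w hst hab ha hb hs hc hn hf hz hp
  exact ⟨w', hst', hP δ hδ a b w hst hab ha hb hs hc hn hf hz hp w' hst' hz' hUC htube, hz', hUC, hcl'⟩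

/-- **Seam, PROVED.** `TubeUniquenessRefP Λ₁ ρ … → BasalReferenceCP Λ₁ ρ … → BasalGapRigidityP Λ₁ …` (the reference over the pinned cell is unique
in its tube, so the configuration is its translate). [this file] -/
theorem basalGapRigidityP_of_uniqRefP {Λ₁ ρ s₁ s₂ t₁ t₂ : ℝ} (hU : TubeUniquenessRefP Λ₁ ρ s₁ s₂ t₁ t₂)
    (hR : BasalReferenceCP Λ₁ ρ s₁ s₂ t₁ t₂) : BasalGapRigidityP Λ₁ s₁ s₂ t₁ t₂ := by
  intro δ hδ a b w hst hab ha hb hsep hcl hna hsf hzero hp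
  obtain ⟨w', hst', htube, hzero', hUC, hcl'⟩ := hR δ hδ a b w hst hab ha hb hsep hcl hna hsf hzero hp
  have hincr : incr w = incr w' :=
    hU (9 / 10) (by norm_num) a b w' hst' hab ha hb (isSep_of_uniformlyClean hUC) hcl' hzero' hUC hp w hst
      (fun m => incr_mem_tube_symm (htube m)) hzero
  obtain ⟨c, hc⟩ := (translation_iff_incr_eq w' w).mpr fun m => by rw [hincr]
  have hw : w = fun m => w' m + c := funext hc
  rw [hw, layered_add_const]
  exact uniformlyClean_translate (-c) hUC

/-! ## §3 Cones -/

/-- ★ **RDEF cone, general form, 7c″P/7c‴P over the pinned cell** (every `Λ Λ₁ ρ₀ ρ₁ s₁ s₂ t₁ t₂ r′ r″ h₁ τ rₛ rₛ″` with `r″ < 1/2`, `r′ + r″ ≤ ρ₁`,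
`0 ≤ rₛ″`, `rₛ ≤ ρ₁`): cone XXII_ref of part XXII with 7c″ := `RegistryPinningP`, 7c‴ := `TubeConvexRefP`. [this file] -/
theorem rdef_of_grossU_shape_gluing_pinningU_convexRefP_registry (Λ Λ₁ ρ₀ ρ₁ s₁ s₂ t₁ t₂ r' r'' h₁ τ rₛ rₛ'' : ℝ) (hr'' : r'' < 1 / 2)
    (hρ₁ : r' + r'' ≤ ρ₁) (hrₛ'' : 0 ≤ rₛ'') (hrₛ : rₛ ≤ ρ₁)
    (hG : GrossCleanBallsU (1 / 250) 10) (hCEG : ChargedEnergyGap) (hC : CompressedVirialLaw (1 / 250) 10)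
    (hS : TwoShellShape (1 / 100) (3 / 50) (1 / 450)) (hB₂ : BarlowGluingW) (hD : DoorPeriodicW Λ) (hSR : StackedReductionW Λ Λ₁)
    (hV : GapStressVanishesW Λ₁) (hP : RegistryPinningP Λ₁ ρ₀ ρ₁ s₁ s₂ t₁ t₂) (hT : TubeConvexRefP Λ₁ ρ₀ s₁ s₂ t₁ t₂)
    (hPin : StackedCellPinningU Λ₁ s₁ s₂ t₁ t₂) (hLoc : RegistryLocalisationW Λ₁ s₁ s₂ r') (hEx : RegistryZeroExists s₁ s₂ r'')
    (hMet : RegistryMetricCW s₁ s₂ r'') (hSqLoc : SqRegistryLocalisationW Λ₁ t₁ t₂ h₁ τ rₛ) (hSqMet : SqRegistryMetricCW t₁ t₂ h₁ τ rₛ'')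
    (hCE : CleanlessExcessT) (hRes : CoherentResidual 10) : RobustDefectLimitWindows :=
  rdef_of_grossU_shape_gluing_stackedP Λ Λ₁ s₁ s₂ t₁ t₂ hG hCEG hC hS hB₂ hD hSR hV hPin
    (basalGapRigidityP_of_uniqRefP (tubeUniquenessRefP_of_tubeConvexRefP hT)
      (basalReferenceCP_of_pinningP (basalReferenceCP_of_registry hr'' hρ₁ hrₛ'' hrₛ hLoc hEx hMet hSqLoc hSqMet) hP)) hCE hRes

/-- ★ **RDEF cone, THIRTIETH form at the numbers of record, reference-centred (proposed CURRENCY OF RECORD): ENERGY PINNING, SQUARE BRANCH EXTINCT,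
TUBE LEAVES OVER THE T-BOX** — cone XXIX_ref with 7c″ := `RegistryPinningP (17/16) (1/40) (3/16) s₁ s₂ 1 0` and 7c‴ := `TubeConvexRefP (17/16) (1/40)
s₁ s₂ 1 0` (with the empty square box the box predicate is `Pinned s₁ s₂ a b`).  Open leaves (19 + `0 < κ′`): slots 1–6, 7a, 7b, 7c″P, 7c‴P, STR, NUM-T,
SQX, R3geo, `BalancedLocus`, R1, R2, R5⁺, 8, 9; literals `s₁ s₂ h₀ κ′` SYMBOLIC. [this file] -/
theorem rdef_thirtieth_of_recordK_boxed_ref (s₁ s₂ h₀ κ' : ℝ) (hκ' : 0 < κ') (hG : GrossCleanBallsU (1 / 250) 10) (hCEG : ChargedEnergyGap)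
    (hC : CompressedVirialLaw (1 / 250) 10) (hS : TwoShellShape (1 / 100) (3 / 50) (1 / 450)) (hB₂ : BarlowGluingW) (hD : DoorPeriodicW 2)
    (hSR : StackedReductionW 2 (17 / 16)) (hV : GapStressVanishesW (17 / 16)) (hP : RegistryPinningP (17 / 16) (1 / 40) (3 / 16) s₁ s₂ 1 0)
    (hT : TubeConvexRefP (17 / 16) (1 / 40) s₁ s₂ 1 0) (hSTR : StraightenedFloor (17 / 16))
    (hNT : StraightCellEnergyT (17 / 16) (3 / 8) (23 / 20) s₁ s₂ (eStar + 2 * κ')) (hX : SquareCellsExtinct (17 / 16) (3 / 8) (23 / 20) (eStar + 2 * κ'))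
    (hGeo : RegistryGeometryW (17 / 16) s₁ s₂ h₀ (3 / 20)) (hBal : BalancedLocus s₁ s₂ h₀ (1 / 40)) (hR1 : RegistryResidual s₁ s₂ (1 / 250))
    (hR2 : RegistryTube s₁ s₂ (1 / 100) 1) (hMet : RegistryMetricCW s₁ s₂ (3 / 500)) (hCE : CleanlessExcessT) (hRes : CoherentResidual 10) :
    RobustDefectLimitWindows :=
  rdef_of_grossU_shape_gluing_pinningU_convexRefP_registry 2 (17 / 16) (1 / 40) (3 / 16) s₁ s₂ 1 0 (7 / 40) (3 / 500) 0 (1 / 100) (4 / 25) 0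
    (by norm_num) (by norm_num) le_rfl (by norm_num) hG hCEG hC hS hB₂ hD hSR hV hP hT (stackedCellPinningU_of_sqExtinct hκ' le_rfl hSTR hNT hX)
    (registryLocalisationW_of_geometry_locus (by norm_num) hGeo hBal)
    (zeroExists_of_residual_tube (by norm_num) (by norm_num) (by norm_num) (by norm_num) (by norm_num) (by norm_num) hR1 hR2) hMet
    (sqRegistryLocalisationW_of_geometry_height (by norm_num) (sqRegistryGeometryW_empty (17 / 16) 0 (3 / 20)) (sqBalancedHeight_empty 0 (1 / 100)))
    (sqRegistryMetricCW_empty 0 (1 / 100) 0) hCE hRes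

/-- ★ **RDEF cone, thirtieth form with the SQUARE BOX SYMBOLIC** (fallback if the critic keeps the square branch): cone XXVIII_ref with 7c″ :=
`RegistryPinningP (17/16) (1/40) (3/16) s₁ s₂ t₁ t₂`, 7c‴ := `TubeConvexRefP (17/16) (1/40) s₁ s₂ t₁ t₂`. [this file] -/
theorem rdef_thirtieth_of_recordK_boxedS_ref (s₁ s₂ t₁ t₂ h₀ h₁ κ' : ℝ) (hκ' : 0 < κ') (hG : GrossCleanBallsU (1 / 250) 10)
    (hCEG : ChargedEnergyGap) (hC : CompressedVirialLaw (1 / 250) 10) (hS : TwoShellShape (1 / 100) (3 / 50) (1 / 450)) (hB₂ : BarlowGluingW)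
    (hD : DoorPeriodicW 2) (hSR : StackedReductionW 2 (17 / 16)) (hV : GapStressVanishesW (17 / 16))
    (hP : RegistryPinningP (17 / 16) (1 / 40) (3 / 16) s₁ s₂ t₁ t₂) (hT : TubeConvexRefP (17 / 16) (1 / 40) s₁ s₂ t₁ t₂)
    (hSTR : StraightenedFloor (17 / 16)) (hNT : StraightCellEnergyT (17 / 16) (3 / 8) (23 / 20) s₁ s₂ (eStar + 2 * κ'))
    (hNS : StraightCellEnergyS (17 / 16) (3 / 8) (23 / 20) t₁ t₂ (eStar + 2 * κ')) (hGeo : RegistryGeometryW (17 / 16) s₁ s₂ h₀ (3 / 20))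
    (hBal : BalancedLocus s₁ s₂ h₀ (1 / 40)) (hR1 : RegistryResidual s₁ s₂ (1 / 250)) (hR2 : RegistryTube s₁ s₂ (1 / 100) 1)
    (hMet : RegistryMetricCW s₁ s₂ (3 / 500)) (hSqGeo : SqRegistryGeometryW (17 / 16) t₁ t₂ h₁ (3 / 20))
    (hSqH : SqBalancedHeight t₁ t₂ h₁ (1 / 100)) (hSqMet : SqRegistryMetricCW t₁ t₂ h₁ (1 / 100) 0) (hCE : CleanlessExcessT)
    (hRes : CoherentResidual 10) : RobustDefectLimitWindows :=
  rdef_of_grossU_shape_gluing_pinningU_convexRefP_registry 2 (17 / 16) (1 / 40) (3 / 16) s₁ s₂ t₁ t₂ (7 / 40) (3 / 500) h₁ (1 / 100) (4 / 25) 0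
    (by norm_num) (by norm_num) le_rfl (by norm_num) hG hCEG hC hS hB₂ hD hSR hV hP hT (stackedCellPinningU_of_straight_band hκ' le_rfl hSTR hNT hNS)
    (registryLocalisationW_of_geometry_locus (by norm_num) hGeo hBal)
    (zeroExists_of_residual_tube (by norm_num) (by norm_num) (by norm_num) (by norm_num) (by norm_num) (by norm_num) hR1 hR2) hMet
    (sqRegistryLocalisationW_of_geometry_height (by norm_num) hSqGeo hSqH) hSqMet hCE hRes

end Summit.AtomisticToContinuum.Crystallization.Theorems.OverbindingBudgetEnergyTubeBox

end
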